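import Mathlib
import Summits.Langlands.Langlands.Theses.EvenArtinQuantumBoundary
import Summits.Langlands.Langlands.Theorems.IrreducibilityBySelfDualityIrreducibleOffSectorLanglandsOfReciprocity
import Summits.Langlands.Langlands.Theorems.IrreducibilityBySelfDualityReciprocityUpToIrreducibilityIsobaricRigidity
import Summits.Langlands.Langlands.Theorems.IrreducibilityBySelfDualityReciprocityUpToIrreducibilityDeRhamBlocks
import Summits.Langlands.Langlands.Theorems.IrreducibilityBySelfDualityReciprocityUpToIrreducibilityGeometricConstituents
import Literature.NumberTheory.Automorphic.IsAutomorphicAE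
import Literature.NumberTheory.Automorphic.GLnAdelicStructureProofs
import HarnessLib

/-!
# BC3 birth skeleton — crux `OffEvenArtin` (item stmt-Langlands-14673) of route `EvenArtinQuantumBoundary`

Skeleton registrar `planner-skel-stmt-Langlands-14673-0`, 2026-08-17 (route re-audit bin REPAIRABLE).
Published as `Cruxes/OffEvenArtin/Lines/birth.lean`.

The crux is the route's COMPLEMENT crux (rank 9):

  `OffEvenArtin := (Artin holomorphy for every irreducible even σ : Γ_ℚ → GL₂(ℂ)) → Langlands`.

Its antecedent — `L(s,σ)` entire for every irreducible even two-dimensional Artin representation of `Γ_ℚ`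
(what the route's bets `QuantumRigidity ∘ GaloisBoundaryBounded` deliver) — buys exactly ONE clause of the
summit: direction (B), in its almost-everywhere (Satake–Frobenius) form, on the EVEN ARTIN SLICE
(`K` of degree one, `n = 2`, `ρ` of Artin type — open kernel — and totally even), by Booker's converse step
(Booker 2003, Corollary p. 1090: one entire `L(s,σ)` ⟹ `σ` automorphic) plus the Satake dictionary and the
L-algebraicity of the `λ = 1/4` archimedean component.  Everything else is GL_n reciprocity proper.  The
skeleton therefore cuts `OffEvenArtin` along the summit's own leaf structure (the five leaves W, B_w, LGC,
JS (2.2), JS (2.3) through which the sibling complement crux `CapacityClassicality.SectorToLanglands` was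
redirected on 2026-08-17, `Cruxes/SectorToLanglands/Lines/SectorToLanglandsOfLeaves.lean`), with the leaf B_w
(weak automorphy) split along the even Artin slice so that the antecedent is LOAD-BEARING:

* `stub_sliceWeakAutomorphy_of_evenArtinHolomorphy` — (antecedent) → B_w ON the slice  [Booker's converse step;
  published theorem modulo transcription: `ι`-transport of `ρ` to a `FramedArtinRep ℚ 2`, degree-one base field,
  Satake–Frobenius dictionary `arithFrobPolyOfSatake`, `IsLAlgebraic` of `π_∞ = π(λ = 1/4)`];
* `stub_weakAutomorphy_offSlice` — B_w OFF the slice  [Fontaine–Mazur–Langlands a.e., every `K`, `n`; open];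
* `stub_weakExistence` — W  [Buzzard–Gee Conj. 3.2.2 weak form, incl. Galois representations for `λ = 1/4`
  Maass forms; open]  (text = child `CapacityClassicality.WeakExistence`, verbatim);
* `stub_pairCompatibility` — LGC  [Taylor 2004 Conj. 7 for irreducible pinned-geometric a.e.-compatible pairs,
  one `Rec` per field; open]  (text = child `CapacityClassicality.PairCompatibility`, verbatim);
* `stub_pairLBoundaryJS`, `stub_pairLPoleJS` — Arthur–Clozel Ch. 3 (2.2)/(2.3) for Borel–Jacquet data
  [Jacquet–Shalika 1981; texts = item stmt-Langlands-13622 `IrreducibilityBySelfDuality.PairLBoundaryJS` and the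
  named fact `JacquetShalika1981_partialPairL_pole_repData` unfolded, verbatim as in the sibling birth files].

`OffEvenArtin_of (h₁ : _Goal.stub₁) … (h₆ : _Goal.stub₆) : OffEvenArtin` is KERNEL-CHECKED below (no sorry outside
`stub_*`; each `_Goal.stub_k : Prop := type_of% @stub_k` is the stub's statement BY NAME, as the registrar requires): the
antecedent feeds stub₁; B_w is reassembled by a case split on the slice predicate; then the isobaric bootstrap
(irreducibility of the pinned-geometric avatar of a cuspidal `π`, landed `stub_geometricConstituents` /
`stub_deRhamBlocks` / `stub_isobaricRigidity`, all sorry-free), the packaging of reciprocity-up-to-irreducibility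
for the `Rec` of LGC, and the landed structural theorem
`IrreducibleOffSector.langlands_of_reciprocityUpToIrreducibility_text_of_JS` (irreducibility of every avatar +
Chebotarev–Brauer–Nesbitt uniqueness) — the same ~70-line seam as `sectorToLanglands_of_leaves`.

Honesty notes.  (i) The slice predicate is intrinsic in the bound field `K`
(`Module.finrank ℚ K = 1 ∧ n = 2 ∧ IsOpen ker ρ ∧ det ρ(c) = 1 at every complex conjugation`), so the
degree-one transport `K ≃ ℚ` is part of stub₁'s burden (mathematically empty, formally not) — unavoidable for
ANY use of a `ℚ`-typed hypothesis toward the `∀ (F : Type)` summit.  (ii) No stub is the crux or the summit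
reworded: stub₁ is Booker's theorem in transcription, stub₂–stub₄ are each strictly weaker than `Langlands`
(consequences of it) and none implies it, stub₅–stub₆ are analytic theorems of Jacquet–Shalika; BC3 probes
`stub → OffEvenArtin`, `stub → Langlands` by `exact? | simpa | aesop` fail 12/12 (seat folder `bc/`).
(iii) Disproof.lean for this crux: none exists (`ledger crux ls stmt-Langlands-14673`); nothing to honour.

References: A. Booker, Ann. of Math. 158 (2003) 1089–1098, Corollary p. 1090 [Booker2003];
K. Buzzard, T. Gee, LMS LNS 414 (2014), Conj. 3.2.1–3.2.2 [BuzzardGeeLMS2014]; J.-M. Fontaine, B. Mazur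
(1995), Conj. 1 [FontaineMazurGeometric1995]; R. Taylor, Ann. Fac. Sci. Toulouse 13 (2004), Conj. 7
[TaylorGaloisRepresentations2004]; J. Arthur, L. Clozel, Ann. Math. Stud. 120, Ch. 3 §2 (2.2)–(2.3)
[ArthurClozelAMS120]; H. Jacquet, J. Shalika, AJM 103 (1981) [JacquetShalikaAJM1981]; F. Calegari, T. Gee,
Ann. Inst. Fourier 63 (2013) §1.1 [CalegariGee2013]; P. Deligne, J.-P. Serre, ASENS 7 (1974) Lemme 3.2
[DeligneSerreASENS1974]; F. Calegari, ICM 2022 survey §12 [Calegari2023].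
-/

noncomputable section

set_option linter.dupNamespace false

open scoped NumberField Classical Polynomial Topology
open Filter IsDedekindDomain Polynomial
open Literature.NumberTheory.Automorphic Literature.NumberTheory.GaloisRepresentations
open Summit.Langlands
open Summit.Langlands.Langlands.Theorems.ReciprocityUpToIrreducibility

namespace Summit.Langlands.Langlands.Cruxes.OffEvenArtin.Birth

/-- **stub 1 — Booker's converse step on the even Artin slice (the antecedent is load-bearing here).**
Artin holomorphy for every irreducible even `σ : Γ_ℚ → GL₂(ℂ)` ⟹ weak automorphy (an L-algebraic cuspidal `π`
of `GL₂(𝔸_K)`, Satake–Frobenius compatible with `ρ` at almost every place) of every irreducible pinned-geometric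
`ρ : Γ_K → GL₂(ℚ̄_ℓ)` ON THE SLICE: `K` of degree one over `ℚ`, `n = 2`, `ρ` of Artin type (open kernel) and
totally even.  Content: transport `ρ` along `ι` to a `FramedArtinRep ℚ 2` (finite image; base field of degree
one), Booker 2003 Corollary (a single entire `L(s,σ)` forces `σ = π(σ)`; solvable images through
Langlands–Tunnell inside the citation), L-algebraicity of `π_∞` (principal series at `ν = 0`), and the Satake
dictionary `charpoly ρ(Frob_v) = arithFrobPolyOfSatake ι q_v 1 α`.  Why plausibly true: published theorem +
bookkeeping; implied by `Langlands`.  Size: L (vendoring Booker as a named fact makes it M).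
[cite: Booker2003, Corollary p. 1090] [cite: BuzzardGeeLMS2014, Conj. 3.2.2 and Rem. 3.2.5] -/
theorem stub_sliceWeakAutomorphy_of_evenArtinHolomorphy :
    (∀ σ : Literature.NumberTheory.GaloisRepresentations.FramedArtinRep ℚ 2, σ.toGaloisRep.IsIrreducible → (∀ (φ : ℚ →+* ℝ) (c : Field.absoluteGaloisGroup ℚ), Literature.NumberTheory.GaloisRepresentations.IsComplexConjugation φ c → Matrix.GeneralLinearGroup.det (σ c) = 1) → Literature.NumberTheory.GaloisRepresentations.LFunction.HasEntireContinuation (Literature.NumberTheory.GaloisRepresentations.artinLFunction σ.toArtinRep)) → ∀ (K : Type) [Field K] [NumberField K] (n : ℕ) (hcpt : Literature.NumberTheory.Automorphic.isCompact_glFiniteIntegralLevel n K), 0 < n → ∀ (ℓ : ℕ) [Fact ℓ.Prime] (ι : PadicAlgCl ℓ ≃+* ℂ) (ρ : Literature.NumberTheory.GaloisRepresentations.FramedGaloisRep K (PadicAlgCl ℓ) n), ρ.toGaloisRep.IsIrreducible → ((∀ᶠ v : IsDedekindDomain.HeightOneSpectrum (NumberField.RingOfIntegers K) in cofinite, ρ.IsUnramifiedAt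 v) ∧ ∀ (v : IsDedekindDomain.HeightOneSpectrum (NumberField.RingOfIntegers K)) (hv : ((ℓ : ℕ) : NumberField.RingOfIntegers K) ∈ v.asIdeal), (Literature.NumberTheory.PAdicHodge.fontainePstAdicCompletion v ℓ hv).IsDeRhamFramed (ρ.toLocal v)) → (Module.finrank ℚ K = 1 ∧ n = 2 ∧ IsOpen ((ρ.toMonoidHom.ker : Set (Field.absoluteGaloisGroup K))) ∧ ∀ (φ : K →+* ℝ) (c : Field.absoluteGaloisGroup K), Literature.NumberTheory.GaloisRepresentations.IsComplexConjugation φ c → Matrix.GeneralLinearGroup.det (ρ c) = 1) → ∃ π : Literature.NumberTheory.Automorphic.CuspidalAutomorphicRepData n K hcpt, π.1.IsLAlgebraic ∧ ∀ᶠ v : IsDedekindDomain.HeightOneSpectrum (NumberField.RingOfIntegers K) in cofinite, SatakeFrobCompatibleAt ι π.1 ρ v := by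
  sorry

/-- **stub 2 — weak automorphy OFF the even Artin slice** (Fontaine–Mazur–Langlands, a.e. form, every number
field `K` and every rank `n`, for irreducible pinned-geometric `ρ` not on the slice): the honest open remainder of
direction (B) — regular / totally-real–CM sectors by automorphy lifting, everything else open.  Strictly weaker
than `Langlands`; does not imply it (no direction (A), no local–global compatibility, nothing on the slice).
[cite: FontaineMazurGeometric1995, Conj. 1] [cite: BuzzardGeeLMS2014, Conj. 3.2.2] -/
theorem stub_weakAutomorphy_offSlice :
    ∀ (K : Type) [Field K] [NumberField K] (n : ℕ) (hcpt : Literature.NumberTheory.Automorphic.isCompact_glFiniteIntegralLevel n K), 0 < n → ∀ (ℓ : ℕ) [Fact ℓ.Prime] (ι : PadicAlgCl ℓ ≃+* ℂ) (ρ : Literature.NumberTheory.GaloisRepresentations.FramedGaloisRep K (PadicAlgCl ℓ) n), ρ.toGaloisRep.IsIrreducible → ((∀ᶠ v : IsDedekindDomain.HeightOneSpectrum (NumberField.RingOfIntegers K) in cofinite, ρ.IsUnramifiedAt v) ∧ ∀ (v : IsDedekindDomain.HeightOneSpectrum (NumberField.RingOfIntegers K)) (hv : ((ℓ : ℕ)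 : NumberField.RingOfIntegers K) ∈ v.asIdeal), (Literature.NumberTheory.PAdicHodge.fontainePstAdicCompletion v ℓ hv).IsDeRhamFramed (ρ.toLocal v)) → ¬ (Module.finrank ℚ K = 1 ∧ n = 2 ∧ IsOpen ((ρ.toMonoidHom.ker : Set (Field.absoluteGaloisGroup K))) ∧ ∀ (φ : K →+* ℝ) (c : Field.absoluteGaloisGroup K), Literature.NumberTheory.GaloisRepresentations.IsComplexConjugation φ c → Matrix.GeneralLinearGroup.det (ρ c) = 1) → ∃ π : Literature.NumberTheory.Automorphic.CuspidalAutomorphicRepData n K hcpt, π.1.IsLAlgebraic ∧ ∀ᶠ v : IsDedekindDomain.HeightOneSpectrum (NumberField.RingOfIntegers K) in cofinite, SatakeFrobCompatibleAt ι π.1 ρ v := by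
  sorry

/-- **stub 3 — W, weak existence** (Buzzard–Gee Conj. 3.2.2, weak form): every L-algebraic cuspidal `π` of
`GL_n(𝔸_K)` has, for every `ℓ`, `ι`, SOME pinned-geometric avatar Satake–Frobenius compatible with it a.e.
(includes the Galois representations of `λ = 1/4` Maass forms — open; Scholze / HLTT over CM fields for regular
`π`).  Text = child `CapacityClassicality.WeakExistence`, verbatim. [cite: BuzzardGeeLMS2014, Conj. 3.2.2] -/
theorem stub_weakExistence :
    ∀ (K : Type) [Field K] [NumberField K] (n : ℕ) (hcpt : Literature.NumberTheory.Automorphic.isCompact_glFiniteIntegralLevel n K), 0 < n → ∀ π : Literature.NumberTheory.Automorphic.CuspidalAutomorphicRepData n K hcpt, π.1.IsLAlgebraic → ∀ (ℓ : ℕ) [Fact ℓ.Prime] (ι : PadicAlgCl ℓ ≃+* ℂ), ∃ ρ : Literature.NumberTheory.GaloisRepresentations.FramedGaloisRep K (PadicAlgCl ℓ) n, ((∀ᶠ v : IsDedekindDomain.HeightOneSpectrum (NumberField.RingOfIntegers K) in cofinite, ρ.IsUnramifiedAt v) ∧ ∀ (v : IsDedekindDomain.HeightOneSpectrum (NumberField.RingOfIntegers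 K)) (hv : ((ℓ : ℕ) : NumberField.RingOfIntegers K) ∈ v.asIdeal), (Literature.NumberTheory.PAdicHodge.fontainePstAdicCompletion v ℓ hv).IsDeRhamFramed (ρ.toLocal v)) ∧ ∀ᶠ v : IsDedekindDomain.HeightOneSpectrum (NumberField.RingOfIntegers K) in cofinite, SatakeFrobCompatibleAt ι π.1 ρ v := by
  sorry

/-- **stub 4 — LGC, local–global compatibility for irreducible pinned-geometric a.e.-compatible pairs** (Taylor
2004 Conj. 7; the only clause carrying `∃ Rec`; covers in particular the all-places upgrade for the even Artin
pairs produced by stub 1).  Text = child `CapacityClassicality.PairCompatibility`, verbatim.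
[cite: TaylorGaloisRepresentations2004, Conj. 7] [cite: HarrisTaylorAMS2001, Thm. A] -/
theorem stub_pairCompatibility :
    ∀ (K : Type) [Field K] [NumberField K], ∃ Rec : ReciprocityData K, ∀ (n : ℕ) (hcpt : Literature.NumberTheory.Automorphic.isCompact_glFiniteIntegralLevel n K), 0 < n → ∀ (π : Literature.NumberTheory.Automorphic.CuspidalAutomorphicRepData n K hcpt), π.1.IsLAlgebraic → ∀ (ℓ : ℕ) [Fact ℓ.Prime] (ι : PadicAlgCl ℓ ≃+* ℂ) (ρ : Literature.NumberTheory.GaloisRepresentations.FramedGaloisRep K (PadicAlgCl ℓ) n), ρ.toGaloisRep.IsIrreducible → ((∀ᶠ v : IsDedekindDomain.HeightOneSpectrum (NumberField.RingOfIntegers K) in cofinite, ρ.IsUnramifiedAt v) ∧ ∀ (v : IsDedekindDomain.HeightOneSpectrum (NumberField.RingOfIntegers K)) (hv : ((ℓ : ℕ) : NumberField.RingOfIntegers K) ∈ v.asIdeal), (Literature.NumberTheory.PAdicHodge.fontainePstAdicCompletion v ℓ hv).IsDeRhamFramed (ρ.toLocal v)) → (∀ᶠ v : IsDedekindDomain.HeightOneSpectrum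 (NumberField.RingOfIntegers K) in cofinite, SatakeFrobCompatibleAt ι π.1 ρ v) → ∀ v : IsDedekindDomain.HeightOneSpectrum (NumberField.RingOfIntegers K), LocalGlobalCompatibleAt Rec ι π.1 ρ v := by
  sorry

/-- **stub 5 — Arthur–Clozel (2.2) for Borel–Jacquet data** (boundary non-vanishing of partial Rankin–Selberg
`L`-functions off the polar configuration; Jacquet–Shalika 1981).  Text = item stmt-Langlands-13622
`IrreducibilityBySelfDuality.PairLBoundaryJS`, verbatim (= named fact
`JacquetShalika1981_partialPairL_boundary_repData`, δ-equal). [cite: ArthurClozelAMS120, Ch. 3 §2 (2.2)]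
[cite: JacquetShalikaAJM1981, I Thm. 5.3] -/
theorem stub_pairLBoundaryJS :
    ∀ (n m : ℕ) (F : Type) [Field F] [NumberField F] (hF : _) (hF' : _), 0 < n → 0 < m → ∀ (π : Literature.NumberTheory.Automorphic.CuspidalAutomorphicRepData n F hF) (π' : Literature.NumberTheory.Automorphic.CuspidalAutomorphicRepData m F hF'), ∃ S₀ : Set (IsDedekindDomain.HeightOneSpectrum (NumberField.RingOfIntegers F)), S₀.Finite ∧ ∀ {S : Set (IsDedekindDomain.HeightOneSpectrum (NumberField.RingOfIntegers F))}, S.Finite → S₀ ⊆ S → ∀ {α β : IsDedekindDomain.HeightOneSpectrum (NumberField.RingOfIntegers F) → Multiset ℂ}, (∀ w ∉ S, π.1.HasSatakeParamAt w (α w)) → (∀ w ∉ S, π'.1.HasSatakeParamAt w (β w)) → (∀ w ∉ S, ‖(α w).prod‖ = 1) → (∀ w ∉ S, ‖(β w).prod‖ = 1) → ∀ {s₀ : ℂ}, s₀.re = 1 → ¬ (n = m ∧ ∀ᶠ w in cofinite, (α w).map ((((w.residueCard : ℂ) ^ (1 - s₀))) * ·) = (β w).map (·⁻¹)) → ∃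 c : ℂ, c ≠ 0 ∧ Tendsto (fun s : ℂ => ∏' w : {w : IsDedekindDomain.HeightOneSpectrum (NumberField.RingOfIntegers F) // w ∉ S}, ((Literature.NumberTheory.Automorphic.satakePairPolynomial (α w.1) (β w.1)).eval ((w.1.residueCard : ℂ) ^ (-s)))⁻¹) (𝓝[{s : ℂ | 1 < s.re}] s₀) (𝓝 c) := by
  sorry

/-- **stub 6 — Arthur–Clozel (2.3) for Borel–Jacquet data** (simple pole of the partial pair `L`-function in the
polar configuration; Jacquet–Shalika 1981).  Text = named fact `JacquetShalika1981_partialPairL_pole_repData` with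
`partialPairL` / `SatakeFamily` unfolded, verbatim as in the sibling birth files (δ/η-equal).
[cite: ArthurClozelAMS120, Ch. 3 §2 (2.3)] [cite: JacquetShalikaAJM1981II, Prop. 3.6 and Thm. 4.4] -/
theorem stub_pairLPoleJS :
    ∀ (n : ℕ) (F : Type) [Field F] [NumberField F] (hF : _), 0 < n → ∀ (π π' : Literature.NumberTheory.Automorphic.CuspidalAutomorphicRepData n F hF), ∃ S₀ : Set (IsDedekindDomain.HeightOneSpectrum (NumberField.RingOfIntegers F)), S₀.Finite ∧ ∀ {S : Set (IsDedekindDomain.HeightOneSpectrum (NumberField.RingOfIntegers F))}, S.Finite → S₀ ⊆ S → ∀ {α β : IsDedekindDomain.HeightOneSpectrum (NumberField.RingOfIntegers F) → Multiset ℂ}, (∀ w ∉ S, π.1.HasSatakeParamAt w (α w)) → (∀ w ∉ S, π'.1.HasSatakeParamAt w (β w)) → (∀ w ∉ S, ‖(α w).prod‖ = 1) → (∀ w ∉ S, ‖(β w).prod‖ = 1) → ∀ {s₀ : ℂ}, s₀.re = 1 → (∀ᶠ w in cofinite, (α w).map ((((w.residueCard : ℂ) ^ (1 - s₀))) * ·)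 = (β w).map (·⁻¹)) → ∃ c : ℂ, c ≠ 0 ∧ Tendsto (fun s : ℂ => (s - s₀) * ∏' w : {w : IsDedekindDomain.HeightOneSpectrum (NumberField.RingOfIntegers F) // w ∉ S}, ((Literature.NumberTheory.Automorphic.satakePairPolynomial (α w.1) (β w.1)).eval ((w.1.residueCard : ℂ) ^ (-s)))⁻¹) (𝓝[{s : ℂ | 1 < s.re}] s₀) (𝓝 c) := by
  sorry

/-! ## The stub statements as named `Prop`s (literally their types) — the registrar's by-name hypotheses -/

namespace _Goal

/-- The statement of `stub_sliceWeakAutomorphy_of_evenArtinHolomorphy`, as a named `Prop` (literally its type; no `sorry` in it). -/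
def stub_sliceWeakAutomorphy_of_evenArtinHolomorphy : Prop :=
  type_of% @Summit.Langlands.Langlands.Cruxes.OffEvenArtin.Birth.stub_sliceWeakAutomorphy_of_evenArtinHolomorphy

/-- The statement of `stub_weakAutomorphy_offSlice`, as a named `Prop` (literally its type; no `sorry` in it). -/
def stub_weakAutomorphy_offSlice : Prop :=
  type_of% @Summit.Langlands.Langlands.Cruxes.OffEvenArtin.Birth.stub_weakAutomorphy_offSlice

/-- The statement of `stub_weakExistence`, as a named `Prop` (literally its type; no `sorry` in it). -/
def stub_weakExistence : Prop :=
  type_of% @Summit.Langlands.Langlands.Cruxes.OffEvenArtin.Birth.stub_weakExistence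

/-- The statement of `stub_pairCompatibility`, as a named `Prop` (literally its type; no `sorry` in it). -/
def stub_pairCompatibility : Prop :=
  type_of% @Summit.Langlands.Langlands.Cruxes.OffEvenArtin.Birth.stub_pairCompatibility

/-- The statement of `stub_pairLBoundaryJS`, as a named `Prop` (literally its type; no `sorry` in it). -/
def stub_pairLBoundaryJS : Prop :=
  type_of% @Summit.Langlands.Langlands.Cruxes.OffEvenArtin.Birth.stub_pairLBoundaryJS

/-- The statement of `stub_pairLPoleJS`, as a named `Prop` (literally its type; no `sorry` in it). -/
def stub_pairLPoleJS : Prop :=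
  type_of% @Summit.Langlands.Langlands.Cruxes.OffEvenArtin.Birth.stub_pairLPoleJS

end _Goal

/-- Read-back: the six stubs prove their named statements (definitionally their own types). -/
theorem goals_hold :
    _Goal.stub_sliceWeakAutomorphy_of_evenArtinHolomorphy ∧ _Goal.stub_weakAutomorphy_offSlice ∧ _Goal.stub_weakExistence ∧
      _Goal.stub_pairCompatibility ∧ _Goal.stub_pairLBoundaryJS ∧ _Goal.stub_pairLPoleJS :=
  ⟨stub_sliceWeakAutomorphy_of_evenArtinHolomorphy, stub_weakAutomorphy_offSlice, stub_weakExistence, stub_pairCompatibility, stub_pairLBoundaryJS, stub_pairLPoleJS⟩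

/-- **`OffEvenArtin` from its six stubs** — kernel-checked composition.  The antecedent of the crux (even Artin
holomorphy over `ℚ`) is consumed by stub 1; weak automorphy B_w is reassembled by a case split on the even Artin
slice; then direction (A)'s irreducibility by the isobaric bootstrap (landed, sorry-free
`stub_geometricConstituents` / `stub_deRhamBlocks` / `stub_isobaricRigidity`), reciprocity-up-to-irreducibility
for the `Rec` of LGC, and the landed structural theorem
`IrreducibleOffSector.langlands_of_reciprocityUpToIrreducibility_text_of_JS`.
[cite: Booker2003, Corollary p. 1090] [cite: BuzzardGeeLMS2014, Conj. 3.2.1 and Conj. 3.2.2]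
[cite: ArthurClozelAMS120, Ch. 3 §2 (2.2)–(2.3)] [cite: CalegariGee2013, §1.1] -/
theorem OffEvenArtin_of
    (h₁ : _Goal.stub_sliceWeakAutomorphy_of_evenArtinHolomorphy) (h₂ : _Goal.stub_weakAutomorphy_offSlice)
    (h₃ : _Goal.stub_weakExistence) (h₄ : _Goal.stub_pairCompatibility)
    (h₅ : _Goal.stub_pairLBoundaryJS) (h₆ : _Goal.stub_pairLPoleJS) :
    Summit.Langlands.Langlands.Theses.EvenArtinQuantumBoundary.OffEvenArtin := by
  -- the stub statements, as the Π-types they literally are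
  have hSlice : type_of% @stub_sliceWeakAutomorphy_of_evenArtinHolomorphy := h₁
  have hOffSlice : type_of% @stub_weakAutomorphy_offSlice := h₂
  have hW : type_of% @stub_weakExistence := h₃
  have hL : type_of% @stub_pairCompatibility := h₄
  have hJSb : type_of% @stub_pairLBoundaryJS := h₅
  have hJSp : type_of% @stub_pairLPoleJS := h₆
  clear h₁ h₂ h₃ h₄ h₅ h₆
  intro hHol
  -- B_w (weak automorphy, every field, rank and irreducible pinned-geometric ρ) from the two slice stubs:
  -- ON the even Artin slice it is Booker's converse step fed by the antecedent `hHol`, OFF it stub 2.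
  have hB : ∀ (K : Type) [Field K] [NumberField K] (n : ℕ) (hcpt : Literature.NumberTheory.Automorphic.isCompact_glFiniteIntegralLevel n K), 0 < n → ∀ (ℓ : ℕ) [Fact ℓ.Prime] (ι : PadicAlgCl ℓ ≃+* ℂ) (ρ : Literature.NumberTheory.GaloisRepresentations.FramedGaloisRep K (PadicAlgCl ℓ) n), ρ.toGaloisRep.IsIrreducible → ((∀ᶠ v : IsDedekindDomain.HeightOneSpectrum (NumberField.RingOfIntegers K) in cofinite, ρ.IsUnramifiedAt v) ∧ ∀ (v : IsDedekindDomain.HeightOneSpectrum (NumberField.RingOfIntegers K)) (hv : ((ℓ : ℕ) : NumberField.RingOfIntegers K) ∈ v.asIdeal), (Literature.NumberTheory.PAdicHodge.fontainePstAdicCompletion v ℓ hv).IsDeRhamFramed (ρ.toLocal v)) → ∃ π : Literature.NumberTheory.Automorphic.CuspidalAutomorphicRepData n K hcpt, π.1.IsLAlgebraic ∧ ∀ᶠ v : IsDedekindDomain.HeightOneSpectrum (NumberField.RingOfIntegers K) in cofinite, SatakeFrobCompatibleAt ι π.1 ρ v := by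
    intro K _ _ n hcpt hn ℓ _ ι ρ hirr hgeo
    by_cases hs : (Module.finrank ℚ K = 1 ∧ n = 2 ∧ IsOpen ((ρ.toMonoidHom.ker : Set (Field.absoluteGaloisGroup K))) ∧ ∀ (φ : K →+* ℝ) (c : Field.absoluteGaloisGroup K), Literature.NumberTheory.GaloisRepresentations.IsComplexConjugation φ c → Matrix.GeneralLinearGroup.det (ρ c) = 1)
    · exact hSlice hHol K n hcpt hn ℓ ι ρ hirr hgeo hs
    · exact hOffSlice K n hcpt hn ℓ ι ρ hirr hgeo hs
  -- the isobaric bootstrap, run with B_w: a pinned-geometric avatar of a cuspidal `π` is irreducible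
  have irr : ∀ (K : Type) [Field K] [NumberField K] (n : ℕ) (hcpt : isCompact_glFiniteIntegralLevel n K)
      (_ : 0 < n) (π : CuspidalAutomorphicRepData n K hcpt) (ℓ : ℕ) [Fact ℓ.Prime]
      (ι : PadicAlgCl ℓ ≃+* ℂ) (ρ : FramedGaloisRep K (PadicAlgCl ℓ) n),
      ((∀ᶠ v : HeightOneSpectrum (𝓞 K) in cofinite, ρ.IsUnramifiedAt v) ∧
        ∀ (v : HeightOneSpectrum (𝓞 K)) (hv : ((ℓ : ℕ) : 𝓞 K) ∈ v.asIdeal),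
          (Literature.NumberTheory.PAdicHodge.fontainePstAdicCompletion v ℓ hv).IsDeRhamFramed
            (ρ.toLocal v)) →
      (∀ᶠ v : HeightOneSpectrum (𝓞 K) in cofinite, SatakeFrobCompatibleAt ι π.1 ρ v) →
        ρ.toGaloisRep.IsIrreducible := by
    intro K _ _ n hcpt hn π ℓ _ ι ρ hgeo hρ
    obtain ⟨k, m, r, hr, hchar, -, hone⟩ :=
      stub_geometricConstituents stub_deRhamBlocks K ℓ n ρ hn hgeo
    by_cases hk1 : k = 1
    · exact hone hk1
    have hk0 : k ≠ 0 := by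
      rintro rfl
      have h1 := hchar 1
      simp only [Finset.univ_eq_empty, Finset.prod_empty] at h1
      have hdeg : (FramedRep.charpoly ρ 1).natDegree = n := by
        simp [FramedRep.charpoly, Matrix.charpoly_natDegree_eq_dim]
      rw [h1, natDegree_one] at hdeg
      omega
    have hk2 : 2 ≤ k := by omega
    have hσ : ∀ i, ∃ σ : CuspidalAutomorphicRepData (m i) K
        (isCompact_glFiniteIntegralLevel_holds (m i) K),
        ∀ᶠ v : HeightOneSpectrum (𝓞 K) in cofinite, SatakeFrobCompatibleAt ι σ.1 (r i) v := by
      intro i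
      obtain ⟨σ, -, hcorr⟩ := hB K (m i) (isCompact_glFiniteIntegralLevel_holds (m i) K) (hr i).1 ℓ ι
        (r i) (hr i).2.1 (hr i).2.2
      exact ⟨σ, hcorr⟩
    choose σ hσc using hσ
    refine (stub_isobaricRigidity hJSb hJSp K n hcpt π k m
      (fun i => isCompact_glFiniteIntegralLevel_holds (m i) K) σ hn hk2 (fun i => (hr i).1) ?_).elim
    have hall : ∀ᶠ v : HeightOneSpectrum (𝓞 K) in cofinite,
        ∀ i, SatakeFrobCompatibleAt ι (σ i).1 (r i) v :=
      Filter.eventually_all.mpr hσc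
    filter_upwards [hρ, hall] with v hv hvi
    intro α hα
    obtain ⟨α₀, hα₀, -, hcp⟩ := hv
    obtain rfl : α = α₀ := AutomorphicRepData.hasSatakeParamAt_unique_holds π.1 hα hα₀
    choose β hβ _hurβ hcpβ using hvi
    refine ⟨β, hβ, ?_⟩
    have hprod : ρ.HasFrobCharpolyAt v (∏ i, arithFrobPolyOfSatake ι v.residueCard 1 (β i)) := by
      intro 𝔓 h𝔓 τ hτ
      rw [hchar τ]
      exact Finset.prod_congr rfl fun i _ => hcpβ i 𝔓 h𝔓 τ hτ
    rw [← Summit.Langlands.Langlands.Theorems.IrreducibleOffSector.arithFrobPolyOfSatake_sum] at hprod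
    have heq : arithFrobPolyOfSatake ι v.residueCard 1 α =
        arithFrobPolyOfSatake ι v.residueCard 1 (∑ i, β i) :=
      GaloisRep.HasFrobCharpolyAt.unique_holds
        ((FramedGaloisRep.hasFrobCharpolyAt_toGaloisRep_iff v _ ρ).mpr hcp)
        ((FramedGaloisRep.hasFrobCharpolyAt_toGaloisRep_iff v _ ρ).mpr hprod)
    exact arithFrobPolyOfSatake_one_injective ι _ heq
  -- reciprocity up to irreducibility (the text of crux stmt-Langlands-14328) for the `Rec` of LGC
  have hE : ∀ (F : Type) [Field F] [NumberField F], ∃ Rec : ReciprocityData F, ∀ n : ℕ, 0 < n →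
      ∀ hcpt : isCompact_glFiniteIntegralLevel n F,
        (∀ π : CuspidalAutomorphicRepData n F hcpt, π.1.IsLAlgebraic →
          ∀ (ℓ : ℕ) [Fact ℓ.Prime] (ι : PadicAlgCl ℓ ≃+* ℂ),
            ∃ ρ : FramedGaloisRep F (PadicAlgCl ℓ) n, IsGeometricFramed Rec ρ ∧ Corresponds Rec ι π.1 ρ) ∧
        GaloisToAutomorphic n Rec hcpt := by
    intro F _ _
    obtain ⟨Rec, hRec⟩ := hL F
    refine ⟨Rec, fun n hn hcpt => ⟨fun π hLalg ℓ _ ι => ?_, fun ℓ _ ι ρ hirr hgeo => ?_⟩⟩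
    · obtain ⟨ρ, hgeo, hρ⟩ := hW F n hcpt hn π hLalg ℓ ι
      have hirr : ρ.toGaloisRep.IsIrreducible := irr F n hcpt hn π ℓ ι ρ hgeo hρ
      exact ⟨ρ, hgeo, hρ, hRec n hcpt hn π hLalg ℓ ι ρ hirr hgeo hρ⟩
    · obtain ⟨π, hLalg, hρ⟩ := hB F n hcpt hn ℓ ι ρ hirr hgeo
      exact ⟨π, hLalg, hρ, hRec n hcpt hn π hLalg ℓ ι ρ hirr hgeo hρ⟩
  -- the summit: irreducibility of every avatar and Chebotarev–Brauer–Nesbitt uniqueness (landed, structural)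
  exact Summit.Langlands.Langlands.Theorems.IrreducibleOffSector.langlands_of_reciprocityUpToIrreducibility_text_of_JS
    hJSb hJSp hE

/-- By-name sanity check (an `example`, not a declaration of the file): the six stubs feed the composition as
they stand — `OffEvenArtin` modulo exactly the six stubs (the only sorries). -/
example : Summit.Langlands.Langlands.Theses.EvenArtinQuantumBoundary.OffEvenArtin :=
  OffEvenArtin_of stub_sliceWeakAutomorphy_of_evenArtinHolomorphy stub_weakAutomorphy_offSlice
    stub_weakExistence stub_pairCompatibility stub_pairLBoundaryJS stub_pairLPoleJS

end Summit.Langlands.Langlands.Cruxes.OffEvenArtin.Birth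

end
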